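import Summits.QuantumFields.YangMills.Theorems.BalabanUVNodesN19TargetAtRecord13CoPH
import Summits.QuantumFields.YangMills.Theorems.BalabanUVNodesN19MGFFormAtRecordMass

/-!
# BalabanUVNodes ∕ N19 (NE7) — node U5's :183 road (∃δ-EDGE FORM) FOR TWO-SIDED KEYED CLASS-WEIGHT TERM DATA: BOTH runs' term weights are FIBRE SUMS of NODE 00's
# dressed class weights along ARBITRARY key maps into a common index type; E1 ∕ E2 DISCHARGED for ANY key maps (module B′ §5), and the class set `T K` BUILT IN-FILE
# as the union of the two images — so that node U5d owes N19's face exactly TWO BARE FUNCTIONS and no admissibility clause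

Cell `pub-ymgap` (HUMAN RULING D-0062, Track A), R134 seat `pub-ymgap-dag-n19-d` (gen 14), strategy s2 «by-name knit»; lane = dag-lead g11 LANE WORD l.21525 (the MGF road's
AT-RECORD seat).  Filed `--kind proof --supports stmt-QuantumFields-20544 --as helper` (K3⁷ `SpineGivenEndpointR13SepCoPH`); COUNT-NEUTRAL.  Sibling of module B″
`…N19TargetClassWeightsE1` (p553397).  [III] = [Balaban1988Convergent], [LF-II] = [Balaban1989LargeFieldII].

WHY (dag-n20-d g26 LOCATED-U5d, bus l.22437, 2026-08-27T18:58:52Z).  Module B″ indexes the classes by run A's sequences of record `ι := Σ K, SeqOfRecord …(gA K) (K₀+K) (K₀+K)`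
and reads node U5d as ONE truncation map `tr K : SeqOfRecord^B_K → SeqOfRecord^A_K` VALUED IN RUN A's ADMISSIBLE SEQUENCES.  n20-d located that no canonical geometric map has
that type: `SeqOfRecord F ν M g K k = Seq (DOfRecord F ν M g K) k` requires `Ω_j, Λ_j ∈ 𝐃_j`, unions of cubes of side `L^j·M·R_j` with `R_j = RkOfRecord L r (g j)`
COUPLING-DEPENDENT, and the two runs' histories are different tunings, so «drop level 0, block by L» is not a function into run A's `SeqOfRecord` on the jump window of `R`.
THIS FILE removes the requirement from N19's side: index the classes by ANY type `ι` and read node U5d as TWO key maps `kA K : SeqOfRecord^A_K → ι`, `kB K : SeqOfRecord^B_K → ι`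
(e.g. «forget admissibility» for run A and «block down by L, then forget» for run B into coupling-free blocked site-set sequences — n20-d's option (b) — or `kA := id`-like
and any fallback-valued `kB` — option (a)); BOTH runs' term weights are then fibre sums, `A K t x := Σ_{s : kA K s = x} classWeightOfDatum₉ … (pA K) (gA K) (K₀+K) t s`,
`B K t x := Σ_{s' : kB K s' = x} classWeightOfDatum₉ … (pB K) (gB K) (K₀+K+1) t s'`, and E1 ∕ E2 are BOTH module B′ §5's `sum_fiberwise_classWeightOfDatum₉_eq_schemeZ_of_ppSelLive`
(`Finset.sum_fiberwise_of_maps_to`), valid for ANY key maps landing in the class set `T K`.  With `T K := univ.image (kA K) ∪ univ.image (kB K)` (§1 ★★, §2 ★★) the maps-to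
provisos disappear: node U5d's deliverable to this face is two bare functions per `K`, nothing else; where the Bad ∕ shell SEMANTICS of a fallback or of a coupling-free key
live is nodes N20 ∕ N21's business inside the displayed hypotheses `h20` ∕ `h21` ∕ `hedge`, exactly as before.
* §1 ANY DATUM `D` with `D.AvgMeasurable`, any Stage-9 tuple at the live selector, laws from the rows ((H-U), (H-ζ), `0 ≤ ζ`, `IsZetaAbsLeOne`, `IsZetaUnity`):
  `schemeZ_eq_sum_fiber_classWeights_keyed` (E1, run A keyed) · `schemeZ_succ_eq_sum_fiber_classWeights_keyed` (E2, run B keyed) ·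
  ★ `matching_scheme_of_coreEdge_keyedClassWeights` (the :183 road, `hE1`∕`hE2` DISCHARGED, class set `T` and maps-to provisos displayed) ·
  ★★ `matching_scheme_of_coreEdge_keyedClassWeights_imageUnion` (class set := union of the two images; NO proviso on the key maps).
* §2 AT NODE 00's v1.7 DATUM `datumOfRecord₁₃CoPH F N θ h` (`θ : Stage13HParams`; rows `h.zetaAbs`∕`h.zetaUnity`, B1 BY NAME):
  ★★ `matching_datumOfRecord₁₃CoPH_of_coreEdge_keyedClassWeights_imageUnion`.

HONEST FRAMING — what this is NOT.  [folklore ∕ bookkeeping]: a by-name composition of module 1's face `matching_scheme_of_coreEdge` with module B′'s fibrewise identity, twice;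
NO estimate (NE7 ∕ NE7b ∕ NE7c NOT PRINTED for d = 4, NOT proved; the ∃δ-edge, `RelWeightBound`, `ShellWeightBound`, `W + Wsh < 1` remain HYPOTHESES); it does NOT build the
Summits-side spine-carrier reading nor node U5d's key maps (parameters here), and does NOT choose among n20-d's (a)∕(b)∕(c) (a definer's ∕ planner's choice — this face accepts
each); nothing of Bałaban's asserted; no `Provisos₁₃CoPH` inhabitant claimed (K0⁷ open); N19 NOT discharged (0∕1); K3⁷ NOT claimed; counts UNMOVED (typed 28∕28 · discharged
5∕27, A 5∕28).  One finite four-torus programme at fixed `ε` — NOT ℝ⁴, NOT infinite volume, NOT OS, NOT a mass gap, NOT the Clay problem.  No `sorry`, no `axiom`, no `instance`,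
no `notation`, no `def` (theorems only).
-/

noncomputable section

namespace Summit.QuantumFields.YangMills.BalabanUVNodes.N19TargetClassWeightsE1Keyed

open MeasureTheory
open scoped BigOperators Matrix.Norms.L2Operator
open Literature.MathematicalPhysics.QuantumFieldTheory.Balaban1983to89
open Literature.MathematicalPhysics.QuantumFieldTheory.Balaban1983to89.Node00
open T4Continuum B14.Eq218Concrete
open T4WeightBudget (RelWeightBound)
open T4IndicatorShell (ShellWeightBound)
open T4CauchySum (MatchingModConstants)
open Summit.QuantumFields.BalabanUV.T4Continuum.Spine
open Summit.QuantumFields.YangMills.BalabanUVNodes.N19TargetAtRecord11 (matching_scheme_of_coreEdge)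
open Summit.QuantumFields.YangMills.BalabanUVNodes.N19MGFFormAtRecord (wOfRecord₉_nonneg wOfRecord₉_le_one)
open Summit.QuantumFields.YangMills.BalabanUVNodes.N19MGFFormAtRecordMass

variable {F : T4Family} {N : ℕ} [NeZero N]

/-! ## §1 Any datum with measurable averaging: E1 ∕ E2 for keyed class weights, and the :183 road with them discharged -/

section AnyDatum

variable (ϑ : Stage9Params F N) (E : B12.RunParams → ℝ) {ι : Type} [DecidableEq ι]

/-- **E1 FOR KEYED CLASS WEIGHTS** (run A at cutoff `(pA K).K = K₀ + K`, full length, summed along ANY key map `kA K` landing in the class set `T K`): for every `K`, every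
source `t`, `schemeZ (D.scheme g₀) os (K₀ + K) t = Σ_{x ∈ T K} Σ_{s : kA K s = x} classWeightOfDatum₉ ϑ D g₀ os (pA K) (gA K) (pA K).K t s` — module B′ §5
`sum_fiberwise_classWeightOfDatum₉_eq_schemeZ_of_ppSelLive` at `k = (pA K).K`. The bound `|t| ≤ l₀` of the face is not needed and not read.
[cite: Balaban1985UV3, (6) p.257; King1986, (3.10) p.656; Balaban1988Convergent, (2.18) p.257 (bookkeeping)] -/
theorem schemeZ_eq_sum_fiber_classWeights_keyed (hsel : ϑ.ppSel = ppSelLiveOfRecord F N ϑ.ν ϑ.τ9 E (wOfRecord₉ F N ϑ))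
    (hU : LocalBgMeasurable F N ϑ.ν) (hζm : ZetaMeasurable F N ϑ.ζ) (hζ0 : ∀ p g k s Pl Ql RS U V', 0 ≤ ϑ.ζ p g k s Pl Ql RS U V')
    (hζ1 : IsZetaAbsLeOne F N ϑ.ν ϑ.τ9.M ϑ.ζ) (hζu : IsZetaUnity F N ϑ.ν ϑ.τ9.M ϑ.ζ)
    (D : FiniteEpsData F (SU N)) (hD : D.AvgMeasurable) (g₀ : ℕ → ℝ) (os : List (ULoop F)) {K₀ : ℕ} (pA : ℕ → B12.RunParams) (gA : ℕ → ℕ → ℝ)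
    (hKA : ∀ K, (pA K).K = K₀ + K) (hgA : ∀ K, gA K 0 = g₀ (pA K).K)
    (T : ℕ → Finset ι) (kA : (K : ℕ) → SeqOfRecord F ϑ.ν ϑ.τ9.M (gA K) (pA K).K (pA K).K → ι) (hkA : ∀ K s, kA K s ∈ T K) (l₀ : ℝ) :
    ∀ (K : ℕ) (t : ℝ), |t| ≤ l₀ →
      T4GenFunBounds.schemeZ (D.scheme g₀) os (K₀ + K) t =
        ∑ x ∈ T K, ∑ s ∈ Finset.univ.filter (fun s : SeqOfRecord F ϑ.ν ϑ.τ9.M (gA K) (pA K).K (pA K).K => kA K s = x),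
          classWeightOfDatum₉ F N ϑ D g₀ os (pA K) (gA K) (pA K).K t s := by
  intro K t _
  rw [← hKA K]
  exact (sum_fiberwise_classWeightOfDatum₉_eq_schemeZ_of_ppSelLive ϑ E hsel (hgA K) (wOfRecord₉_nonneg ϑ hζ0 _ _) (wOfRecord₉_le_one ϑ hζ1 _ _)
    (fun k s' => measurable_wOfRecord_of_localBg hU ϑ.τ9.M ϑ.A₁ hζm _ _ k s') (fun k s => measurable_chiSeqOfRecord_of_localBg hU ϑ.τ9.M _ _ k s) hζu D hD os t
    (pA K).K le_rfl (T K) (kA K) (hkA K)).symm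

/-- **E2 FOR KEYED CLASS WEIGHTS** (run B at cutoff `(pB K).K = K₀ + K + 1`, full length, summed along ANY key map `kB K` landing in the same class set `T K`):
`schemeZ (D.scheme g₀) os (K₀ + K + 1) t = Σ_{x ∈ T K} Σ_{s' : kB K s' = x} classWeightOfDatum₉ ϑ D g₀ os (pB K) (gB K) (pB K).K t s'` — module B′ §5 again, at run B's
tuple.  No admissibility of anything is read: `kB K` is a bare function (node U5d's «block down, then key»).
[cite: Balaban1985UV3, (6) p.257; King1986, (3.10) p.656; Balaban1988Convergent, (2.18) p.257 (bookkeeping)] -/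
theorem schemeZ_succ_eq_sum_fiber_classWeights_keyed (hsel : ϑ.ppSel = ppSelLiveOfRecord F N ϑ.ν ϑ.τ9 E (wOfRecord₉ F N ϑ))
    (hU : LocalBgMeasurable F N ϑ.ν) (hζm : ZetaMeasurable F N ϑ.ζ) (hζ0 : ∀ p g k s Pl Ql RS U V', 0 ≤ ϑ.ζ p g k s Pl Ql RS U V')
    (hζ1 : IsZetaAbsLeOne F N ϑ.ν ϑ.τ9.M ϑ.ζ) (hζu : IsZetaUnity F N ϑ.ν ϑ.τ9.M ϑ.ζ)
    (D : FiniteEpsData F (SU N)) (hD : D.AvgMeasurable) (g₀ : ℕ → ℝ) (os : List (ULoop F)) {K₀ : ℕ} (pB : ℕ → B12.RunParams) (gB : ℕ → ℕ → ℝ)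
    (hKB : ∀ K, (pB K).K = K₀ + K + 1) (hgB : ∀ K, gB K 0 = g₀ (pB K).K)
    (T : ℕ → Finset ι) (kB : (K : ℕ) → SeqOfRecord F ϑ.ν ϑ.τ9.M (gB K) (pB K).K (pB K).K → ι) (hkB : ∀ K s', kB K s' ∈ T K) (l₀ : ℝ) :
    ∀ (K : ℕ) (t : ℝ), |t| ≤ l₀ →
      T4GenFunBounds.schemeZ (D.scheme g₀) os (K₀ + K + 1) t =
        ∑ x ∈ T K, ∑ s' ∈ Finset.univ.filter (fun s' : SeqOfRecord F ϑ.ν ϑ.τ9.M (gB K) (pB K).K (pB K).K => kB K s' = x),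
          classWeightOfDatum₉ F N ϑ D g₀ os (pB K) (gB K) (pB K).K t s' := by
  intro K t _
  rw [← hKB K]
  exact (sum_fiberwise_classWeightOfDatum₉_eq_schemeZ_of_ppSelLive ϑ E hsel (hgB K) (wOfRecord₉_nonneg ϑ hζ0 _ _) (wOfRecord₉_le_one ϑ hζ1 _ _)
    (fun k s' => measurable_wOfRecord_of_localBg hU ϑ.τ9.M ϑ.A₁ hζm _ _ k s') (fun k s => measurable_chiSeqOfRecord_of_localBg hU ϑ.τ9.M _ _ k s) hζu D hD os t
    (pB K).K le_rfl (T K) (kB K) (hkB K)).symm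

/-- **★ N19's :183 ROAD (∃δ-EDGE FORM) FOR TWO-SIDED KEYED CLASS-WEIGHT TERM DATA, E1 ∕ E2 DISCHARGED.**  At any datum `D` with measurable averaging, any Stage-9 tuple pinned
at the live selector (laws from the rows), runs `pA K` ∕ `pB K` at cutoffs `K₀ + K` ∕ `K₀ + K + 1` with histories starting at the dressing's coupling, ANY class sets `T K` of
ANY index type `ι` and ANY key maps `kA K`, `kB K` of the two runs' sequences of record into `T K`: N20's `RelWeightBound`, N21's `ShellWeightBound`, U4′'s `W + Wsh < 1` and
N19's ∃δ-edge FOR THE KEYED TERM DATA (`A` ∕ `B` = the two fibre sums of F3's class weights; shells ∕ bad sets ∕ weights abstract) ⇒ `∃ δ′, Summable δ′ ∧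
MatchingModConstants vol l₀ δ′ (schemeZ (D.scheme g₀) os)` — module 1's `matching_scheme_of_coreEdge` with `hE1`∕`hE2` supplied by the two previous lemmas.
[cite: Balaban1985UV3, (6) p.257; Balaban1989LargeFieldII, Thm 1 + (0.1) pp.355–356; King1986, (3.10) p.656 (bookkeeping)] -/
theorem matching_scheme_of_coreEdge_keyedClassWeights (hsel : ϑ.ppSel = ppSelLiveOfRecord F N ϑ.ν ϑ.τ9 E (wOfRecord₉ F N ϑ))
    (hU : LocalBgMeasurable F N ϑ.ν) (hζm : ZetaMeasurable F N ϑ.ζ) (hζ0 : ∀ p g k s Pl Ql RS U V', 0 ≤ ϑ.ζ p g k s Pl Ql RS U V')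
    (hζ1 : IsZetaAbsLeOne F N ϑ.ν ϑ.τ9.M ϑ.ζ) (hζu : IsZetaUnity F N ϑ.ν ϑ.τ9.M ϑ.ζ)
    (D : FiniteEpsData F (SU N)) (hD : D.AvgMeasurable) (g₀ : ℕ → ℝ) (os : List (ULoop F)) {K₀ : ℕ} (pA pB : ℕ → B12.RunParams) (gA gB : ℕ → ℕ → ℝ)
    (hKA : ∀ K, (pA K).K = K₀ + K) (hKB : ∀ K, (pB K).K = K₀ + K + 1) (hgA : ∀ K, gA K 0 = g₀ (pA K).K) (hgB : ∀ K, gB K 0 = g₀ (pB K).K)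
    (T : ℕ → Finset ι) (kA : (K : ℕ) → SeqOfRecord F ϑ.ν ϑ.τ9.M (gA K) (pA K).K (pA K).K → ι)
    (kB : (K : ℕ) → SeqOfRecord F ϑ.ν ϑ.τ9.M (gB K) (pB K).K (pB K).K → ι) (hkA : ∀ K s, kA K s ∈ T K) (hkB : ∀ K s', kB K s' ∈ T K)
    {l₀ vol : ℝ} (hl₀ : 0 ≤ l₀) (hvol : 0 < vol)
    {shA shB : ℕ → ℝ → ι → ℝ} {Bad : ℕ → ℝ → Finset ι} {W Wsh : ℕ → ℝ}
    (h20 : RelWeightBound l₀ T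
      (fun K t x => ∑ s ∈ Finset.univ.filter (fun s : SeqOfRecord F ϑ.ν ϑ.τ9.M (gA K) (pA K).K (pA K).K => kA K s = x),
        classWeightOfDatum₉ F N ϑ D g₀ os (pA K) (gA K) (pA K).K t s)
      (fun K t x => ∑ s' ∈ Finset.univ.filter (fun s' : SeqOfRecord F ϑ.ν ϑ.τ9.M (gB K) (pB K).K (pB K).K => kB K s' = x),
        classWeightOfDatum₉ F N ϑ D g₀ os (pB K) (gB K) (pB K).K t s') Bad W)
    (h21 : ShellWeightBound l₀ T
      (fun K t x => ∑ s ∈ Finset.univ.filter (fun s : SeqOfRecord F ϑ.ν ϑ.τ9.M (gA K) (pA K).K (pA K).K => kA K s = x),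
        classWeightOfDatum₉ F N ϑ D g₀ os (pA K) (gA K) (pA K).K t s)
      (fun K t x => ∑ s' ∈ Finset.univ.filter (fun s' : SeqOfRecord F ϑ.ν ϑ.τ9.M (gB K) (pB K).K (pB K).K => kB K s' = x),
        classWeightOfDatum₉ F N ϑ D g₀ os (pB K) (gB K) (pB K).K t s') shA shB Wsh)
    (hlt : ∀ K, W K + Wsh K < 1)
    (hedge : ∃ δ : ℕ → ℝ, NE7.Core l₀ vol T Bad
      (fun K t x => (∑ s ∈ Finset.univ.filter (fun s : SeqOfRecord F ϑ.ν ϑ.τ9.M (gA K) (pA K).K (pA K).K => kA K s = x),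
        classWeightOfDatum₉ F N ϑ D g₀ os (pA K) (gA K) (pA K).K t s) - shA K t x)
      (fun K t x => (∑ s' ∈ Finset.univ.filter (fun s' : SeqOfRecord F ϑ.ν ϑ.τ9.M (gB K) (pB K).K (pB K).K => kB K s' = x),
        classWeightOfDatum₉ F N ϑ D g₀ os (pB K) (gB K) (pB K).K t s') - shB K t x) δ ∧ Summable δ) :
    ∃ δ' : ℕ → ℝ, Summable δ' ∧ MatchingModConstants vol l₀ δ' (T4GenFunBounds.schemeZ (D.scheme g₀) os) :=
  matching_scheme_of_coreEdge D hD g₀ os hl₀ hvol h20 h21 hlt hedge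
    (schemeZ_eq_sum_fiber_classWeights_keyed ϑ E hsel hU hζm hζ0 hζ1 hζu D hD g₀ os pA gA hKA hgA T kA hkA l₀)
    (schemeZ_succ_eq_sum_fiber_classWeights_keyed ϑ E hsel hU hζm hζ0 hζ1 hζu D hD g₀ os pB gB hKB hgB T kB hkB l₀)

/-- **★★ THE SAME ROAD WITH THE CLASS SET BUILT IN-FILE** — `T K := univ.image (kA K) ∪ univ.image (kB K)`: both key maps land in it by construction
(`Finset.mem_union`, `Finset.mem_image_of_mem`), so NO proviso on `kA` ∕ `kB` is displayed.  Node U5d's deliverable to N19's face is thereby reduced to two BARE FUNCTIONS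
per cutoff (run A's sequences of record → keys, run B's → keys), with no `𝐃_j`-membership clause on their values.
[cite: Balaban1985UV3, (6) p.257; Balaban1989LargeFieldII, Thm 1 + (0.1) pp.355–356; King1986, (3.10) p.656 (bookkeeping)] -/
theorem matching_scheme_of_coreEdge_keyedClassWeights_imageUnion (hsel : ϑ.ppSel = ppSelLiveOfRecord F N ϑ.ν ϑ.τ9 E (wOfRecord₉ F N ϑ))
    (hU : LocalBgMeasurable F N ϑ.ν) (hζm : ZetaMeasurable F N ϑ.ζ) (hζ0 : ∀ p g k s Pl Ql RS U V', 0 ≤ ϑ.ζ p g k s Pl Ql RS U V')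
    (hζ1 : IsZetaAbsLeOne F N ϑ.ν ϑ.τ9.M ϑ.ζ) (hζu : IsZetaUnity F N ϑ.ν ϑ.τ9.M ϑ.ζ)
    (D : FiniteEpsData F (SU N)) (hD : D.AvgMeasurable) (g₀ : ℕ → ℝ) (os : List (ULoop F)) {K₀ : ℕ} (pA pB : ℕ → B12.RunParams) (gA gB : ℕ → ℕ → ℝ)
    (hKA : ∀ K, (pA K).K = K₀ + K) (hKB : ∀ K, (pB K).K = K₀ + K + 1) (hgA : ∀ K, gA K 0 = g₀ (pA K).K) (hgB : ∀ K, gB K 0 = g₀ (pB K).K)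
    (kA : (K : ℕ) → SeqOfRecord F ϑ.ν ϑ.τ9.M (gA K) (pA K).K (pA K).K → ι)
    (kB : (K : ℕ) → SeqOfRecord F ϑ.ν ϑ.τ9.M (gB K) (pB K).K (pB K).K → ι)
    {l₀ vol : ℝ} (hl₀ : 0 ≤ l₀) (hvol : 0 < vol)
    {shA shB : ℕ → ℝ → ι → ℝ} {Bad : ℕ → ℝ → Finset ι} {W Wsh : ℕ → ℝ}
    (h20 : RelWeightBound l₀ (fun K => Finset.univ.image (kA K) ∪ Finset.univ.image (kB K))
      (fun K t x => ∑ s ∈ Finset.univ.filter (fun s : SeqOfRecord F ϑ.ν ϑ.τ9.M (gA K) (pA K).K (pA K).K => kA K s = x),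
        classWeightOfDatum₉ F N ϑ D g₀ os (pA K) (gA K) (pA K).K t s)
      (fun K t x => ∑ s' ∈ Finset.univ.filter (fun s' : SeqOfRecord F ϑ.ν ϑ.τ9.M (gB K) (pB K).K (pB K).K => kB K s' = x),
        classWeightOfDatum₉ F N ϑ D g₀ os (pB K) (gB K) (pB K).K t s') Bad W)
    (h21 : ShellWeightBound l₀ (fun K => Finset.univ.image (kA K) ∪ Finset.univ.image (kB K))
      (fun K t x => ∑ s ∈ Finset.univ.filter (fun s : SeqOfRecord F ϑ.ν ϑ.τ9.M (gA K) (pA K).K (pA K).K => kA K s = x),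
        classWeightOfDatum₉ F N ϑ D g₀ os (pA K) (gA K) (pA K).K t s)
      (fun K t x => ∑ s' ∈ Finset.univ.filter (fun s' : SeqOfRecord F ϑ.ν ϑ.τ9.M (gB K) (pB K).K (pB K).K => kB K s' = x),
        classWeightOfDatum₉ F N ϑ D g₀ os (pB K) (gB K) (pB K).K t s') shA shB Wsh)
    (hlt : ∀ K, W K + Wsh K < 1)
    (hedge : ∃ δ : ℕ → ℝ, NE7.Core l₀ vol (fun K => Finset.univ.image (kA K) ∪ Finset.univ.image (kB K)) Bad
      (fun K t x => (∑ s ∈ Finset.univ.filter (fun s : SeqOfRecord F ϑ.ν ϑ.τ9.M (gA K) (pA K).K (pA K).K => kA K s = x),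
        classWeightOfDatum₉ F N ϑ D g₀ os (pA K) (gA K) (pA K).K t s) - shA K t x)
      (fun K t x => (∑ s' ∈ Finset.univ.filter (fun s' : SeqOfRecord F ϑ.ν ϑ.τ9.M (gB K) (pB K).K (pB K).K => kB K s' = x),
        classWeightOfDatum₉ F N ϑ D g₀ os (pB K) (gB K) (pB K).K t s') - shB K t x) δ ∧ Summable δ) :
    ∃ δ' : ℕ → ℝ, Summable δ' ∧ MatchingModConstants vol l₀ δ' (T4GenFunBounds.schemeZ (D.scheme g₀) os) :=
  matching_scheme_of_coreEdge_keyedClassWeights ϑ E hsel hU hζm hζ0 hζ1 hζu D hD g₀ os pA pB gA gB hKA hKB hgA hgB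
    (fun K => Finset.univ.image (kA K) ∪ Finset.univ.image (kB K)) kA kB
    (fun _ s => Finset.mem_union_left _ (Finset.mem_image_of_mem _ (Finset.mem_univ s)))
    (fun _ s' => Finset.mem_union_right _ (Finset.mem_image_of_mem _ (Finset.mem_univ s'))) hl₀ hvol h20 h21 hlt hedge

end AnyDatum

/-! ## §2 At NODE 00's v1.7 datum of record `datumOfRecord₁₃CoPH F N θ h` (def-T FILE 27 p537939): rows `zetaAbs` ∕ `zetaUnity` and B1 BY NAME -/

section AtRecordCoPH

variable {ι : Type} [DecidableEq ι]

/-- **★★ N19's :183 ROAD AT THE v1.7 DATUM OF RECORD FOR TWO-SIDED KEYED CLASS-WEIGHT TERM DATA, E1 ∕ E2 DISCHARGED, CLASS SET BUILT IN-FILE** (`θ : Stage13HParams`,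
`h : θ.Provisos₁₃CoPH F N`; the dressed family run at `θ.toStage9Params`, started at the record's own datum; live-selector pin; displayed: `0 ≤ ζ`, (H-U), (H-ζ); rows
`h.zetaAbs` ∕ `h.zetaUnity`, B1 `isPrintedAveraged_datumOfRecord₁₃CoPH` BY NAME): node U5d enters as two bare key maps `kA` ∕ `kB`, nothing else.
[cite: Balaban1985UV3, (6) p.257; Balaban1989LargeFieldII, Thm 1 + (0.1) pp.355–356; King1986, (3.10) p.656 (bookkeeping)] -/
theorem matching_datumOfRecord₁₃CoPH_of_coreEdge_keyedClassWeights_imageUnion (θ : Stage13HParams F N) (h : θ.Provisos₁₃CoPH F N) (E : B12.RunParams → ℝ)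
    (hsel : θ.ppSel = ppSelLiveOfRecord F N θ.ν θ.τ9 E (wOfRecord₉ F N θ.toStage9Params))
    (hU : LocalBgMeasurable F N θ.ν) (hζm : ZetaMeasurable F N θ.ζ) (hζ0 : ∀ p g k s Pl Ql RS U V', 0 ≤ θ.ζ p g k s Pl Ql RS U V')
    (g₀ : ℕ → ℝ) (os : List (ULoop F)) {K₀ : ℕ} (pA pB : ℕ → B12.RunParams) (gA gB : ℕ → ℕ → ℝ)
    (hKA : ∀ K, (pA K).K = K₀ + K) (hKB : ∀ K, (pB K).K = K₀ + K + 1) (hgA : ∀ K, gA K 0 = g₀ (pA K).K) (hgB : ∀ K, gB K 0 = g₀ (pB K).K)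
    (kA : (K : ℕ) → SeqOfRecord F θ.ν θ.τ9.M (gA K) (pA K).K (pA K).K → ι)
    (kB : (K : ℕ) → SeqOfRecord F θ.ν θ.τ9.M (gB K) (pB K).K (pB K).K → ι)
    {l₀ vol : ℝ} (hl₀ : 0 ≤ l₀) (hvol : 0 < vol)
    {shA shB : ℕ → ℝ → ι → ℝ} {Bad : ℕ → ℝ → Finset ι} {W Wsh : ℕ → ℝ}
    (h20 : RelWeightBound l₀ (fun K => Finset.univ.image (kA K) ∪ Finset.univ.image (kB K))
      (fun K t x => ∑ s ∈ Finset.univ.filter (fun s : SeqOfRecord F θ.ν θ.τ9.M (gA K) (pA K).K (pA K).K => kA K s = x),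
        classWeightOfDatum₉ F N θ.toStage9Params (datumOfRecord₁₃CoPH F N θ h) g₀ os (pA K) (gA K) (pA K).K t s)
      (fun K t x => ∑ s' ∈ Finset.univ.filter (fun s' : SeqOfRecord F θ.ν θ.τ9.M (gB K) (pB K).K (pB K).K => kB K s' = x),
        classWeightOfDatum₉ F N θ.toStage9Params (datumOfRecord₁₃CoPH F N θ h) g₀ os (pB K) (gB K) (pB K).K t s') Bad W)
    (h21 : ShellWeightBound l₀ (fun K => Finset.univ.image (kA K) ∪ Finset.univ.image (kB K))
      (fun K t x => ∑ s ∈ Finset.univ.filter (fun s : SeqOfRecord F θ.ν θ.τ9.M (gA K) (pA K).K (pA K).K => kA K s = x),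
        classWeightOfDatum₉ F N θ.toStage9Params (datumOfRecord₁₃CoPH F N θ h) g₀ os (pA K) (gA K) (pA K).K t s)
      (fun K t x => ∑ s' ∈ Finset.univ.filter (fun s' : SeqOfRecord F θ.ν θ.τ9.M (gB K) (pB K).K (pB K).K => kB K s' = x),
        classWeightOfDatum₉ F N θ.toStage9Params (datumOfRecord₁₃CoPH F N θ h) g₀ os (pB K) (gB K) (pB K).K t s') shA shB Wsh)
    (hlt : ∀ K, W K + Wsh K < 1)
    (hedge : ∃ δ : ℕ → ℝ, NE7.Core l₀ vol (fun K => Finset.univ.image (kA K) ∪ Finset.univ.image (kB K)) Bad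
      (fun K t x => (∑ s ∈ Finset.univ.filter (fun s : SeqOfRecord F θ.ν θ.τ9.M (gA K) (pA K).K (pA K).K => kA K s = x),
        classWeightOfDatum₉ F N θ.toStage9Params (datumOfRecord₁₃CoPH F N θ h) g₀ os (pA K) (gA K) (pA K).K t s) - shA K t x)
      (fun K t x => (∑ s' ∈ Finset.univ.filter (fun s' : SeqOfRecord F θ.ν θ.τ9.M (gB K) (pB K).K (pB K).K => kB K s' = x),
        classWeightOfDatum₉ F N θ.toStage9Params (datumOfRecord₁₃CoPH F N θ h) g₀ os (pB K) (gB K) (pB K).K t s') - shB K t x) δ ∧ Summable δ) :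
    ∃ δ' : ℕ → ℝ, Summable δ' ∧
      MatchingModConstants vol l₀ δ' (T4GenFunBounds.schemeZ ((datumOfRecord₁₃CoPH F N θ h).scheme g₀) os) :=
  matching_scheme_of_coreEdge_keyedClassWeights_imageUnion θ.toStage9Params E hsel hU hζm hζ0 h.zetaAbs h.zetaUnity (datumOfRecord₁₃CoPH F N θ h)
    (isPrintedAveraged_datumOfRecord₁₃CoPH F N θ h).avgMeasurable g₀ os pA pB gA gB hKA hKB hgA hgB kA kB hl₀ hvol h20 h21 hlt hedge

end AtRecordCoPH

end Summit.QuantumFields.YangMills.BalabanUVNodes.N19TargetClassWeightsE1Keyed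

end
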